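import Literature.MathematicalPhysics.QuantumFieldTheory.Balaban1983to89.B8Prop6CubeMemberFlatScalarBdryBeta
import Literature.MathematicalPhysics.QuantumFieldTheory.Balaban1983to89.B8Prop6CubeMemberFlat3Gamma
import Literature.MathematicalPhysics.QuantumFieldTheory.Balaban1983to89.B8SockHFP59Gamma

/-!
# `Balaban1983to89.B8Prop6CubeMemberFlatScalarGamma` — [Balaban1985RegularSpaces] PROPOSITION 6 (p. 99), EXISTENCE HALF, AT THE CONCRETE CUBE MEMBER FROM
# THREE REAL INEQUALITY FAMILIES + THE (1.59) CLAUSE FOR `G(1)` — EDITION γ (averaging index over the split print class `cubeLamBP'` ∪ {level-0 crossing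
# bonds of `□₀`}; box law «box ⊂ □_{j−1}»; [3] Prop. 4's windows one level lower)

statement-level skeleton of published theorems with citation tags; proofs where landed; nothing here is a claim about the
Yang–Mills mass gap

Sources: `[Balaban1985RegularSpaces]` Prop. 6 p. 99, Thm 4 p. 88, Prop. 5 (1.106)–(1.109) p. 94, Prop. 3 p. 87, (1.92) p. 91, (1.98) p. 92, (1.101) p. 93, (1.58)–(1.59)
p. 86, (1.66) p. 87, (1.31) p. 82; [4] = `[Balaban1985BackgroundPropagators]` Thms 3.1–3.3 pp. 397–399.  PDF held `paper:balaban1985-cmp99-regular-spaces-gauge-fixing`.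

CITATION HEADER (lean-in-tree rule).  Cell `pub-ymgap` (HUMAN RULING D-0062, Track A), DAG node N05 = [B8], seat `pub-ymgap-dag-n05-e` g10 (R141 (C) row s3b —
the FLAT line of Proposition 6's cube road, edition γ; file Fγ5).  WHY THIS FILE.  g8's `B8Prop6CubeMemberFlatScalarBdryBeta` (p553065) puts the existence half
of Proposition 6 at the cube member modulo three REAL inequality families (dag-n05-c's supply line — all PROVED since: F4e∕F7∕F8∕G3) and the (1.59) clause in
EDITION β over `cubeLamB` — VACUOUS at cube members (shell modes, dag-n05-c p572834).  EDITION γ re-keys the (1.59) clause to the split print class `cubeLamBP'`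
(inner AND crossing bonds at every level) and runs on the γ bricks: this seat's `B8Prop6CubeMemberFlat3Gamma` (Fγ4), `B8SockHFP59Gamma` (Fγ2), the class-parametric
⊗-id transfer `B8Ineq159FlatOfScalarBdryBeta.flat159_clause_of_scalar_bdryβ` (H1, unchanged), k0-s2-w1's laws `B8CubeMemberLamBPrimeLaws`, dag-n05-c's datum
dictionary `thm4_hypotheses_one_cutFixed_γ`, and the γ windows `B8Thm4ExistsConcreteGamma.thm4_windows_γ` ([3] Prop. 4 one level lower, (1.61) with
`C₂ := 16·131072(d+1)²·L²`) read at `α₂ := c⋆ ≤ 2(L c⋆) + 8α₄`.  ★★ `prop6_cubeMember_flat_of_real_γ` (REAL families + `H59Dβ₁` over `cubeLamBP'`), ★★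
`prop6_cubeMember_flat_of_scalar_γ` (REAL families + the SCALAR flat γ clauses).  Proofs = p553065's with the γ substitutions.  Kind «kernel-checked proof»,
theorems only, no `def`.

HONEST SCOPE ∕ A6.  (i) Nothing of [4] proved here: the three real families are displayed HYPOTHESES (discharged downstream by dag-n05-c F8∕G3 on print's
sub-lattice), and the (1.59) clause for `G(1)` on the finite cube WITH exterior data over the split print class is a HYPOTHESIS — print's (1.59) ([4] Thm 3.3 at
`U = 1`), named `Ineq159FlatCubeMemberPrinted` (dag-n05-c, OPEN); its scalar form is INHABITED per cube (dag-n05-w3 p585691 via this seat's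
`B8Ineq159FlatCubeMemberSCGamma.sc4_cubeMember_inhabited`) — no vacuity in edition γ; the uniform constant is the named fact's content.  (ii) Only the
EXISTENCE half of Prop. 6; the (1.136) norm members are Fγ3's.  (iii) `B_∂`, `4B_∂ ≤ (dL − 1)B₀` are the tree's.  Count-neutral; N05 NOT discharged; one finite
`𝕋⁴` programme at fixed `ε`, Bałaban as printed; nothing continuum ∕ ℝ⁴ ∕ OS ∕ mass-gap ∕ Clay.  No `sorry`, no `def`, no `instance`, no `notation`.  Unit
`pub-ymgap-dag-n05-e` (g10), 2026-08-28.
-/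

noncomputable section

namespace Literature.MathematicalPhysics.QuantumFieldTheory.Balaban1983to89.B8Prop6CubeMemberFlatScalarGamma


open scoped Matrix
open B7Prop1Explicit B7Prop2Explicit B7Prop1Local B7Eq92Concrete B8Ineq130
open B7Prop2Explicit (C0 c2')
open B7Prop3Flat (c3)
open B7Prop10General (C6)
open B7Eq78Linearization (QprimeIter zdBlocking)
open B8Ineq132 (covDerivFwd InAk BondTouches)
open B8Ineq133 (cutFixed)
open B8Eq115GaugeFixing (localGauge)
open B8Eq119TwistedAxial (InAx Restr129 bgT)
open B8Eq184Proof (gaugeExp cfgExp)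
open B8Lemma1NonAbelian (mulCfg)
open B8Eq140Level (SideTouches)
open B8Eq146AExpansion (iEta)
open B7Prop4GeneralLevels (linCovIter)
open B8Eq155JBound (Jcur wsup)
open B8ScaledSupNorm (bondNorm msup)
open B8Thm2LogB (blockTop)
open B8Eq138LandauZd (IsLandau138W logCfg covLap QT)
open B8Eq1117Concrete (XSpace)
open B8Prop5ContractionKLevel (Bd2)
open B8LambdaSpaceKLevel (wt)
open B8Eq131Cubes (tcube tLo tHi ctr)
open B8Eq131CubesAdmissible (cubeFam)
open B8CubeMemberZd (cubeLamS cubeLamB hΩ_cubeFam hbox_cubeLamB hclass_cubeLamB)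
open B8Ineq133CubeMemberGamma (thm4_hypotheses_one_cutFixed_γ)
open B8Prop6CubeMemberFlat3Gamma (prop6_exists_cubeMember_at_γ₃)
open B9SupplySockB9P3ZdGamma (cubeLamBP')
open B8CubeMemberLamBPrimeLaws (cubeLamBP'_hbox_pred cubeLamBP'_hclass)
open B8Thm4ExistsConcreteGamma (thm4_windows_γ)
open B8LeafKnitZd3CubBdryBeta (bdryLayer_cubeMember)
open B9SupplySockB9P3ZdBeta (CrossB)
open B8SockHFPWindows (hfpWindows_of_guard)
open B7ConclGaugeLin (two_le_C6')
open B8SockHFPRD (sockHFP₀_body_of_join_RD)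
open B8SockHFP59Gamma (sockHFP_body_of_join_59_γ)
open B8SockHFPCubeMember (htw_cubeLamS h8lt_cubeLamS h8top_cubeLamS)
open B8Prop5KLevelLetters (hP5base_of_HFP hP5_of_HFP)
open Literature.MathematicalPhysics.QuantumLattice (blockMap)
open B8Eq191FlatLettersDirichlet (exists_towerFinset)
open B8Eq191FlatLettersCubeMember (cubeLamS_finite cubeFam_zero_finite cubeFam_subset_zero tower_meets_cube towers_disjoint_cube)
open B8Eq191FlatLettersRDOfReal (flatLettersRD_of_real)
open B8Ineq159FlatOfScalarBdryBeta (flat159_clause_of_scalar_bdryβ)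
open B8Eq138LandauZd (IsLandau138)

export B7Prop1Explicit (Site)

variable {d : ℕ}

variable {𝔸 : Type} [CStarAlgebra 𝔸] [Nontrivial 𝔸]

/-! ## Proposition 6 at the cube member from three real inequality families and the REPAIRED (1.59) clause for `G(1)` -/

open Classical in
/-- ★★ **PROPOSITION 6 (p. 99), EXISTENCE HALF, AT THE CONCRETE CUBE MEMBER FROM THREE REAL INEQUALITY FAMILIES AND THEOREM 4's (1.59) CLAUSE
`H59Dβ₁` AT BACKGROUND `1`, EDITION γ** — g8's `prop6_cubeMember_flat_of_real_bdryβ` (p553065) with the (1.59) clause's averaging index over the split print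
class `cubeLamBP' … m j ∪ {level-0 crossing bonds of □₀}`; the three REAL families VERBATIM ((1.101) for `T⁻¹`, (1.92)+`Δ`-entry for `T⁻¹(T⁻¹Qᵀ)(QT⁻¹T⁻¹Qᵀ)⁻¹`,
(1.98) for `1 − T⁻¹Qᵀ(QT⁻¹T⁻¹Qᵀ)⁻¹QT⁻¹`, real lattice functions, Dirichlet on `□₀`); Proposition 5's base from the REAL letters (`sockHFP₀_body_of_join_RD`,
unchanged), its step from `B8SockHFP59Gamma.sockHFP_body_of_join_59_γ` with the five γ windows derived here from `thm4_windows_γ`; assembled by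
`B8Prop6CubeMemberFlat3Gamma.prop6_exists_cubeMember_at_γ₃`.  Threshold `min (min c₀ c_P) c₃`.
[cite: Balaban1985RegularSpaces, Prop. 6 p.99, Thm 4 p.88, Prop. 5 (1.106)–(1.109) p.94, Prop. 3 p.87, (1.92) p.91, (1.98) p.92, (1.101) p.93, (1.59) p.86, (1.31) p.82; Balaban1985BackgroundPropagators, Thms 3.1–3.3 pp.397–399] -/
theorem prop6_cubeMember_flat_of_real_γ (hd2 : 2 ≤ d) {L : ℕ} (hL : 2 ≤ L) {B₀ B₀' B₀'H B₂' BG BR : ℝ} (hB₀ : 0 < B₀) (hB₀' : 0 < B₀')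
    (hB : 2 ≤ 5 * (d : ℝ) * L * B₀) (hB₀'H : 0 < B₀'H) (hB₂' : 0 ≤ B₂') (hBG : 0 ≤ BG) (hBR : 0 ≤ BR)
    (hfree : 3 * (2 * (d : ℝ) * (L : ℝ) ^ 2) * BG * BR ≤ B₀') {Bbd : ℝ} (hBbd : 0 ≤ Bbd) (hBd : 4 * Bbd ≤ ((d : ℝ) * L - 1) * B₀) :
    ∃ c₁ : ℝ, 0 < c₁ ∧ ∀ (η : ℝ), 0 < η → ∀ (k : ℕ), 1 ≤ k → ∀ (a : Site d) (M ρ : ℕ), L ≤ ρ → ρ ≤ M → 11 * (d : ℝ) < M →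
      ∀ (U₀ : Site d → Fin d → 𝔸ˣ), (∀ x κ, U₀ x κ ∈ unitaryUnits 𝔸) → ∀ (α₀ : ℝ), 0 < α₀ →
      C0 d * (α₀ * (L : ℝ) ^ 2) ≤ 1 / 3 → 2 * (α₀ * (L : ℝ) ^ 2) ≤ c2' d L →
      ∀ (Ω : ℕ → Set (Site d)), InAk L k η α₀ Ω U₀ → tcube L a M ρ k ⊆ Ω (k - 1) →
      11 * (d : ℝ) ^ 2 * (L : ℝ) ^ 2 * α₀ + ((M : ℝ) + 4 * ρ) * d * (L : ℝ) ^ 2 * α₀ ≤ 1 / 6 →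
      (L : ℝ) ^ 3 * α₀ + 6 * d * (L : ℝ) ^ 2 * M * α₀ ≤ c₁ →
      -- the weights of `Q′ᵀaQ′` (free, nonnegative) and THE THREE REAL INEQUALITY FAMILIES at every truncation `n ≤ k` on the explicit matrices
      ∀ (w : ℕ → ℝ), (∀ j, 0 ≤ w j) →
      (∀ n, 1 ≤ n → n ≤ k → ∀ (S : Finset (Site d)), (∀ x, x ∈ S ↔ x ∈ cubeFam false L a M ρ k 0) →
        ∀ (B : Finset (ℕ × Site d)), (∀ p, p ∈ B ↔ p.1 ≤ n ∧ p.2 ∈ cubeLamS L a M ρ k n p.1) →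
        ∀ (K : Site d → Site d → ℝ), (∀ x z, K x z =
          ((η ^ 2)⁻¹ * ∑ μ : Fin d, ((2 : ℝ) * (if z = x then (1 : ℝ) else 0) - (if z = x + e μ then (1 : ℝ) else 0)
            - (if z = x - e μ then (1 : ℝ) else 0))) +
          (∑ j ∈ Finset.range (n + 1), (if blockMap (L ^ j) x ∈ cubeLamS L a M ρ k n j ∧ blockMap (L ^ j) z = blockMap (L ^ j) x then
            w j * ((((L : ℝ) ^ d)⁻¹) ^ j) ^ 2 else 0))) →
        ∀ (T : Matrix ↥S ↥S ℝ), T = Matrix.of (fun x z : ↥S => K x.1 z.1) →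
        ∀ (Q : Matrix ↥B ↥S ℝ), Q = Matrix.of (fun (p : ↥B) (z : ↥S) =>
          if blockMap (L ^ p.1.1) z.1 = p.1.2 then (((L : ℝ) ^ d)⁻¹) ^ p.1.1 else 0) →
        -- (1.101) for `T⁻¹`, real lattice functions
        (∀ (ρ' : ↥S → ℝ) (r : ℝ), 0 ≤ r →
          (∀ j, j ≤ n → ∀ z : ↥S, z.1 ∈ cubeFam false L a M ρ k j → wt L η j ^ 2 * |ρ' z| ≤ r) →
          ∀ φ : Site d → ℝ, (∀ x, x ∉ cubeFam false L a M ρ k 0 → φ x = 0) → (∀ v : ↥S, φ v.1 = ∑ z : ↥S, T⁻¹ v z * ρ' z) →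
          (∀ x, |φ x| ≤ BG * r) ∧
          ∀ j, j ≤ n → ∀ p ∈ {b : Site d × Fin d | SideTouches (cubeFam false L a M ρ k j) b.1 b.2},
            wt L η j * |η⁻¹ * (φ (p.1 + e p.2) - φ p.1)| ≤ BG * r) ∧
        -- (1.92) and the p. 93 `Δ`-entry for `T⁻¹(T⁻¹Qᵀ)(QT⁻¹T⁻¹Qᵀ)⁻¹`, real `X`
        (∀ (X : ↥B → ℝ) (s : ℝ), 0 ≤ s → (∀ p', |X p'| ≤ s) →
          ∀ φ : Site d → ℝ, (∀ x, x ∉ cubeFam false L a M ρ k 0 → φ x = 0) →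
          (∀ v : ↥S, φ v.1 = ∑ p' : ↥B, (T⁻¹ * (T⁻¹ * Qᵀ) * (Q * T⁻¹ * T⁻¹ * Qᵀ)⁻¹) v p' * X p') →
          (∀ x, |φ x| ≤ B₀'H * s) ∧
          (∀ j, j ≤ n → ∀ p ∈ {b : Site d × Fin d | SideTouches (cubeFam false L a M ρ k j) b.1 b.2},
            wt L η j * |η⁻¹ * (φ (p.1 + e p.2) - φ p.1)| ≤ B₀'H * s) ∧
          (∀ j, j ≤ n → ∀ x ∈ cubeFam false L a M ρ k j,
            wt L η j ^ 2 * |∑ μ : Fin d, (η ^ 2)⁻¹ * (2 * φ x - φ (x + e μ) - φ (x - e μ))| ≤ B₂' * s)) ∧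
        -- (1.98) for `1 − T⁻¹Qᵀ(QT⁻¹T⁻¹Qᵀ)⁻¹QT⁻¹`, real lattice functions
        (∀ (ρ' : ↥S → ℝ) (r : ℝ), 0 ≤ r →
          (∀ j, j ≤ n → ∀ z : ↥S, z.1 ∈ cubeFam false L a M ρ k j → wt L η j ^ 2 * |ρ' z| ≤ r) →
          ∀ j, j ≤ n → ∀ v : ↥S, v.1 ∈ cubeFam false L a M ρ k j →
            wt L η j ^ 2 * |ρ' v - ∑ z : ↥S, (T⁻¹ * (Qᵀ * ((Q * T⁻¹ * T⁻¹ * Qᵀ)⁻¹ * (Q * T⁻¹)))) v z * ρ' z| ≤ BR * r)) →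
      -- (1.59) for `G(1)` IN THE REPAIRED CURRENCY — Theorem 4's two-member clause at background `1` with the support clause and the
      -- exterior-collar allowance (VERBATIM `B8Prop6CubeMemberFlat3Bdry`'s `H59D₁`)
      ((∀ m, 1 ≤ m → m ≤ k → ∀ (u : Site d → 𝔸ˣ) (W : Site d → Fin d → 𝔸ˣ) (A' : Site d → Fin d → 𝔸),
        (∀ x, u x ∈ unitaryUnits 𝔸) → (∀ x, x ∉ (cubeFam false L a M ρ k) 0 → u x = 1) →
          mgauge (1 : Site d → Fin d → 𝔸ˣ) u W = (cutFixed L (tLo a ρ) (tHi a M ρ) U₀ k (ctr a M)) →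
          Restr129 L m ((cubeLamS L a M ρ k) m) (1 : Site d → Fin d → 𝔸ˣ) u →
          IsLandau138W L m η ((cubeFam false L a M ρ k) 0) ((cubeLamS L a M ρ k) m) (1 : Site d → Fin d → 𝔸ˣ) W →
        (∀ y τ, IsSelfAdjoint (A' y τ)) →
        (∀ j, j ≤ m → ∀ y τ, SideTouches ((cubeFam false L a M ρ k) j) y τ →
        W y τ = cfgExp η A' y τ ∧
          ‖A' y τ‖ ≤ (2 * (L * (5 * (d : ℝ) * L * B₀ * (((L : ℝ) ^ 3 * α₀) + (6 * d * (L : ℝ) ^ 2 * M * α₀)))) + 8 * (8 * B₀' * (5 * (d : ℝ) * L * B₀) * (((L : ℝ) ^ 3 * α₀) + (6 * d * (L : ℝ) ^ 2 * M * α₀)))) * ((L : ℝ) ^ j * η)⁻¹) →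
        (∀ y τ, (∀ j, j ≤ m → ¬ SideTouches ((cubeFam false L a M ρ k) j) y τ) → A' y τ = 0) →
        msup L m η (-(1 : ℝ)) (fun j (b : Site d × Fin d) => SideTouches ((cubeFam false L a M ρ k) j) b.1 b.2) (fun b => A' b.1 b.2)
        ≤ B₀ * (bondNorm L m η (-(3 : ℝ)) (cubeFam false L a M ρ k) (fun x μ => Jcur η (1 : Site d → Fin d → 𝔸ˣ) A' μ x)
        + wsup 1 (fun p : {p : ℕ × (Site d × Fin d) // p.1 ≤ m ∧ (p.2 ∈ (cubeLamBP' L a M ρ k) m p.1 ∨ (p.1 = 0 ∧ CrossB ((cubeFam false L a M ρ k) 0) p.2))} =>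
        linCovIter L (1 : Site d → Fin d → 𝔸ˣ) (iEta η A') p.1.1 p.1.2.1 p.1.2.2))
        + Bbd * msup L m η (-(1 : ℝ)) (fun j (b : Site d × Fin d) => j = 0 ∧ SideTouches ((cubeFam false L a M ρ k) 0) b.1 b.2 ∧
            ¬ BondTouches ((cubeFam false L a M ρ k) 0) b.1 b.2) (fun b => A' b.1 b.2) ∧
        msup L m η (-(2 : ℝ)) (fun j (t : Fin d × Fin d × Site d) => SideTouches ((cubeFam false L a M ρ k) j) t.2.2 t.2.1)
        (fun t => covDerivFwd η (1 : Site d → Fin d → 𝔸ˣ) t.1 (fun z => A' z t.2.1) t.2.2)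
        ≤ B₀ * (bondNorm L m η (-(3 : ℝ)) (cubeFam false L a M ρ k) (fun x μ => Jcur η (1 : Site d → Fin d → 𝔸ˣ) A' μ x)
        + wsup 1 (fun p : {p : ℕ × (Site d × Fin d) // p.1 ≤ m ∧ (p.2 ∈ (cubeLamBP' L a M ρ k) m p.1 ∨ (p.1 = 0 ∧ CrossB ((cubeFam false L a M ρ k) 0) p.2))} =>
        linCovIter L (1 : Site d → Fin d → 𝔸ˣ) (iEta η A') p.1.1 p.1.2.1 p.1.2.2))
        + Bbd * msup L m η (-(1 : ℝ)) (fun j (b : Site d × Fin d) => j = 0 ∧ SideTouches ((cubeFam false L a M ρ k) 0) b.1 b.2 ∧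
            ¬ BondTouches ((cubeFam false L a M ρ k) 0) b.1 b.2) (fun b => A' b.1 b.2))) →
      ∃ u : Site d → 𝔸ˣ, (∀ x, u x ∈ unitaryUnits 𝔸) ∧ (∀ x, x ∉ cubeFam false L a M ρ k 0 → u x = 1) ∧
        Restr129 L k (cubeLamS L a M ρ k k) (1 : Site d → Fin d → 𝔸ˣ) u ∧
        IsLandau138W L k η (cubeFam false L a M ρ k 0) (cubeLamS L a M ρ k k) (1 : Site d → Fin d → 𝔸ˣ)
          (gaugeAct u⁻¹ (cutFixed L (tLo a ρ) (tHi a M ρ) U₀ k (ctr a M))) ∧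
        (∀ j, j ≤ k → ∀ b ∈ {b : Site d × Fin d | SideTouches (cubeFam false L a M ρ k j) b.1 b.2},
          gaugeAct u⁻¹ (cutFixed L (tLo a ρ) (tHi a M ρ) U₀ k (ctr a M)) b.1 b.2 =
              cfgExp η (logCfg η (gaugeAct u⁻¹ (cutFixed L (tLo a ρ) (tHi a M ρ) U₀ k (ctr a M)))) b.1 b.2 ∧
            IsSelfAdjoint (logCfg η (gaugeAct u⁻¹ (cutFixed L (tLo a ρ) (tHi a M ρ) U₀ k (ctr a M))) b.1 b.2) ∧
            ‖logCfg η (gaugeAct u⁻¹ (cutFixed L (tLo a ρ) (tHi a M ρ) U₀ k (ctr a M))) b.1 b.2‖ ≤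
              (5 * (d : ℝ) * L * B₀ * ((L : ℝ) ^ 3 * α₀ + 6 * d * (L : ℝ) ^ 2 * M * α₀)) * ((L : ℝ) ^ j * η)⁻¹) ∧
        (∀ x, ((localGauge L (tLo a ρ) (tHi a M ρ) U₀ k (ctr a M))⁻¹ * u) x ∈ unitaryUnits 𝔸) ∧
        AgreeOn (tlo L (tLo a ρ) k) (thi L (tHi a M ρ) k)
          (gaugeAct ((localGauge L (tLo a ρ) (tHi a M ρ) U₀ k (ctr a M))⁻¹ * u)⁻¹ U₀)
          (gaugeAct u⁻¹ (cutFixed L (tLo a ρ) (tHi a M ρ) U₀ k (ctr a M))) := by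
  have hL1 : 1 ≤ L := le_trans (by norm_num) hL
  have hd1 : 1 ≤ d := le_trans (by norm_num) hd2
  have hd0 : 0 < d := hd1
  have hLr : (1 : ℝ) ≤ L := by exact_mod_cast hL1
  have hdr : (1 : ℝ) ≤ d := by exact_mod_cast hd1
  have hC6 : (2 : ℝ) ≤ C6 d := two_le_C6'
  obtain ⟨c₀, hc₀, P6⟩ := prop6_exists_cubeMember_at_γ₃ (𝔸 := 𝔸) hd2 hL hB₀ hB₀' hB hBbd hBd
  obtain ⟨cP, hcP, WIN⟩ := hfpWindows_of_guard hd1 hL1 hB₀ hB₀' hB hB₀'H hB₂' hBG hBR one_pos hfree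
  obtain ⟨c₃, hc₃γ0, WINγ⟩ := thm4_windows_γ hd1 hL1 hB₀ hB₀' hB
  refine ⟨min (min c₀ cP) c₃, lt_min (lt_min hc₀ hcP) hc₃γ0, ?_⟩
  intro η hη k hk a M ρ hρL hρM hM U₀ hU₀ α₀ hα hα3 hα2 Ω hA hT hsmall hc w hw REAL H59
  have hc0 : (L : ℝ) ^ 3 * α₀ + 6 * d * (L : ℝ) ^ 2 * M * α₀ ≤ c₀ := hc.trans ((min_le_left _ _).trans (min_le_left _ _))
  have hcP' : (L : ℝ) ^ 3 * α₀ + 6 * d * (L : ℝ) ^ 2 * M * α₀ ≤ cP := hc.trans ((min_le_left _ _).trans (min_le_right _ _))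
  have hc3' : (L : ℝ) ^ 3 * α₀ + 6 * d * (L : ℝ) ^ 2 * M * α₀ ≤ c₃ := hc.trans (min_le_right _ _)
  have hρ : 1 ≤ ρ := hL1.trans hρL
  have hM1 : 1 ≤ M := hρ.trans hρM
  have hLpos : (0 : ℝ) < L := by positivity
  have hMpos : (0 : ℝ) < M := by exact_mod_cast hM1
  have hdpos : (0 : ℝ) < d := by exact_mod_cast hd0
  have hα₀' : 0 < (L : ℝ) ^ 3 * α₀ := by positivity
  have hα₁' : 0 < 6 * (d : ℝ) * (L : ℝ) ^ 2 * M * α₀ := by positivity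
  -- the pair `(1, U₀″)` at the member
  obtain ⟨hmem, h33, h34, hAx, h135, h66⟩ :=
    thm4_hypotheses_one_cutFixed_γ L hL hd1 k U₀ hU₀ hα hα3 hα2 a hρ hρM hM hη hA hT hsmall
  have hone : ∀ x κ, (1 : Site d → Fin d → 𝔸ˣ) x κ ∈ unitaryUnits 𝔸 := fun _ _ => (unitaryUnits 𝔸).one_mem
  -- the windows at `(α₀, α₁) := (L³α₀, 6dL²Mα₀)`
  obtain ⟨hside, -, -, hsmall₁, -, -, hα3', hα4', hsmallW, hc₃, hsc, hα₃', hs₁, hs₂, hs₃, hs₄, hs₅, hs₆, hs₇, hsm, hprod8, hcA',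
    ha₁', hb₁', hθ, h103, h106⟩ := WIN _ _ hα₀' hα₁' hcP' _ _ _ _ _ _ _ _ rfl rfl rfl rfl rfl rfl rfl rfl
  -- EDITION γ: [3] Prop. 4's windows one level lower and the (1.61) window with `C₂ := 16·131072(d+1)²·L²`, read at `α₂ := c⋆ ≤ 2(L c⋆) + 8α₄`
  obtain ⟨g5, g6, g7, g9, g10, g13, g14⟩ := WINγ _ _ hα₀' hα₁' hc3' _ _ rfl rfl
  -- smallness read by the plain-currency bridges: `α₄ ≤ 1/84`, `c⋆ ≤ 1/12`, `a ≤ 1/4`, `2a ≤ c⋆`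
  have hsum0 : 0 ≤ (L : ℝ) ^ 3 * α₀ + 6 * d * (L : ℝ) ^ 2 * M * α₀ := by positivity
  have hcs0 : 0 ≤ 5 * (d : ℝ) * L * B₀ * ((L : ℝ) ^ 3 * α₀ + 6 * d * (L : ℝ) ^ 2 * M * α₀) := by positivity
  have hα₄0 : 0 ≤ 8 * B₀' * (5 * (d : ℝ) * L * B₀) * ((L : ℝ) ^ 3 * α₀ + 6 * d * (L : ℝ) ^ 2 * M * α₀) := by positivity
  have hs84 : 8 * B₀' * (5 * (d : ℝ) * L * B₀) * ((L : ℝ) ^ 3 * α₀ + 6 * d * (L : ℝ) ^ 2 * M * α₀) ≤ 1 / 84 := by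
    have h := mul_le_mul_of_nonneg_right hC6 (mul_nonneg (by norm_num : (0 : ℝ) ≤ 2) hα₄0)
    nlinarith only [hs₁, h, hα₄0]
  have hcs12 : 5 * (d : ℝ) * L * B₀ * ((L : ℝ) ^ 3 * α₀ + 6 * d * (L : ℝ) ^ 2 * M * α₀) ≤ 1 / 12 := by
    have h1 : 5 * (d : ℝ) * L * B₀ * ((L : ℝ) ^ 3 * α₀ + 6 * d * (L : ℝ) ^ 2 * M * α₀) ≤
        L * (5 * (d : ℝ) * L * B₀ * ((L : ℝ) ^ 3 * α₀ + 6 * d * (L : ℝ) ^ 2 * M * α₀)) := le_mul_of_one_le_left hcs0 hLr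
    have h2 : L * (5 * (d : ℝ) * L * B₀ * ((L : ℝ) ^ 3 * α₀ + 6 * d * (L : ℝ) ^ 2 * M * α₀)) ≤
        d * (L * (5 * (d : ℝ) * L * B₀ * ((L : ℝ) ^ 3 * α₀ + 6 * d * (L : ℝ) ^ 2 * M * α₀))) :=
      le_mul_of_one_le_left (mul_nonneg hLpos.le hcs0) hdr
    linarith only [h1, h2, hsc]
  have ha : 6 * (d : ℝ) * (L : ℝ) ^ 2 * M * α₀ ≤ 1 / 4 := by
    have h1 : 6 * (d : ℝ) * (L : ℝ) ^ 2 * M * α₀ ≤ (d : ℝ) * L * (6 * (d : ℝ) * (L : ℝ) ^ 2 * M * α₀) := by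
      have hdL : (1 : ℝ) ≤ (d : ℝ) * L := one_le_mul_of_one_le_of_one_le hdr hLr
      exact le_mul_of_one_le_left hα₁'.le hdL
    linarith only [h1, hsmall₁]
  have ha2 : 2 * (6 * (d : ℝ) * (L : ℝ) ^ 2 * M * α₀) ≤ 5 * (d : ℝ) * L * B₀ * ((L : ℝ) ^ 3 * α₀ + 6 * d * (L : ℝ) ^ 2 * M * α₀) := by
    have h1 : 2 * (6 * (d : ℝ) * (L : ℝ) ^ 2 * M * α₀) ≤ 2 * ((L : ℝ) ^ 3 * α₀ + 6 * d * (L : ℝ) ^ 2 * M * α₀) := by linarith only [hα₀']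
    exact h1.trans (mul_le_mul_of_nonneg_right hB hsum0)
  -- the γ windows at `α₂ := c⋆` (monotone in `c⋆ ≤ 2(L c⋆) + 8α₄`)
  have hcsw : 5 * (d : ℝ) * L * B₀ * ((L : ℝ) ^ 3 * α₀ + 6 * d * (L : ℝ) ^ 2 * M * α₀) ≤
      2 * (L * (5 * (d : ℝ) * L * B₀ * ((L : ℝ) ^ 3 * α₀ + 6 * d * (L : ℝ) ^ 2 * M * α₀)))
        + 8 * (8 * B₀' * (5 * (d : ℝ) * L * B₀) * ((L : ℝ) ^ 3 * α₀ + 6 * d * (L : ℝ) ^ 2 * M * α₀)) := by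
    have h1 : 5 * (d : ℝ) * L * B₀ * ((L : ℝ) ^ 3 * α₀ + 6 * d * (L : ℝ) ^ 2 * M * α₀) ≤
        L * (5 * (d : ℝ) * L * B₀ * ((L : ℝ) ^ 3 * α₀ + 6 * d * (L : ℝ) ^ 2 * M * α₀)) := le_mul_of_one_le_left hcs0 hLr
    linarith only [h1, hcs0, hα₄0]
  have hLcsw := mul_le_mul_of_nonneg_left hcsw hLpos.le
  have h16γ : 16 * ((L : ℝ) * (5 * (d : ℝ) * L * B₀ * ((L : ℝ) ^ 3 * α₀ + 6 * d * (L : ℝ) ^ 2 * M * α₀))) ≤ 1 := by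
    linarith only [g7, hLcsw]
  have hsmallγ : Real.exp (4 * (800 * ((d : ℝ) + 1) ^ 2 * ((d : ℝ) + 4)) * ((L : ℝ) ^ 2 * ((L : ℝ) ^ 3 * α₀)))
      * (1 + 8 * (131072 * ((d : ℝ) + 1) ^ 2) * ((L : ℝ) * (5 * (d : ℝ) * L * B₀ * ((L : ℝ) ^ 3 * α₀ + 6 * d * (L : ℝ) ^ 2 * M * α₀)))) ≤ 2 := by
    refine le_trans (mul_le_mul_of_nonneg_left ?_ (Real.exp_pos _).le) g9
    have h := mul_le_mul_of_nonneg_left hLcsw (show (0 : ℝ) ≤ 8 * (131072 * ((d : ℝ) + 1) ^ 2) by positivity)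
    linarith only [h]
  have hc₃γ : 2 * ((L : ℝ) * (5 * (d : ℝ) * L * B₀ * ((L : ℝ) ^ 3 * α₀ + 6 * d * (L : ℝ) ^ 2 * M * α₀))) ≤ c3 d L := by
    linarith only [g10, hLcsw]
  have h61γ : 2 * (5 * (d : ℝ) * L * B₀ * ((L : ℝ) ^ 3 * α₀ + 6 * d * (L : ℝ) ^ 2 * M * α₀)) ^ 2
      + 20 * d * ((L : ℝ) ^ 3 * α₀) * (5 * (d : ℝ) * L * B₀ * ((L : ℝ) ^ 3 * α₀ + 6 * d * (L : ℝ) ^ 2 * M * α₀))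
      + 2 * (16 * (131072 * ((d : ℝ) + 1) ^ 2) * (L : ℝ) ^ 2) * (5 * (d : ℝ) * L * B₀ * ((L : ℝ) ^ 3 * α₀ + 6 * d * (L : ℝ) ^ 2 * M * α₀)) ^ 2
      ≤ (L : ℝ) ^ 3 * α₀ + 6 * d * (L : ℝ) ^ 2 * M * α₀ := by
    have hsq : (5 * (d : ℝ) * L * B₀ * ((L : ℝ) ^ 3 * α₀ + 6 * d * (L : ℝ) ^ 2 * M * α₀)) ^ 2 ≤
        (2 * (L * (5 * (d : ℝ) * L * B₀ * ((L : ℝ) ^ 3 * α₀ + 6 * d * (L : ℝ) ^ 2 * M * α₀)))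
          + 8 * (8 * B₀' * (5 * (d : ℝ) * L * B₀) * ((L : ℝ) ^ 3 * α₀ + 6 * d * (L : ℝ) ^ 2 * M * α₀))) ^ 2 :=
      pow_le_pow_left₀ hcs0 hcsw 2
    have hlin : 20 * d * ((L : ℝ) ^ 3 * α₀) * (5 * (d : ℝ) * L * B₀ * ((L : ℝ) ^ 3 * α₀ + 6 * d * (L : ℝ) ^ 2 * M * α₀)) ≤
        20 * d * ((L : ℝ) ^ 3 * α₀) * (2 * (L * (5 * (d : ℝ) * L * B₀ * ((L : ℝ) ^ 3 * α₀ + 6 * d * (L : ℝ) ^ 2 * M * α₀)))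
          + 8 * (8 * B₀' * (5 * (d : ℝ) * L * B₀) * ((L : ℝ) ^ 3 * α₀ + 6 * d * (L : ℝ) ^ 2 * M * α₀))) :=
      mul_le_mul_of_nonneg_left hcsw (by positivity)
    have hK0 : (0 : ℝ) ≤ 2 * (16 * (131072 * ((d : ℝ) + 1) ^ 2) * (L : ℝ) ^ 2) := by positivity
    have hsq' := mul_le_mul_of_nonneg_left hsq hK0
    linarith only [g14, hsq, hlin, hsq']
  -- the member's geometry (edition γ: the split print class `cubeLamBP'`, box law «box ⊂ □_{j−1}», inner ∕ crossing ∕ mirrored trichotomy)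
  have hΩc := hΩ_cubeFam (d := d) hL1 a M hρL k
  have hboxc := cubeLamBP'_hbox_pred (d := d) hL1 a M hρL k
  have hclassc := cubeLamBP'_hclass (d := d) hL1 a M hρL k
  have htw := htw_cubeLamS (d := d) hL1 a M ρ k
  have h8lt := h8lt_cubeLamS (d := d) L a M ρ k
  have h8top := h8top_cubeLamS (d := d) hL1 a M ρ k
  refine P6 η hη k hk a M ρ hρL hρM hM U₀ hU₀ α₀ hα hα3 hα2 Ω hA hT hsmall hc0 ?_ ?_ H59
  · -- `P5base₁`: the base body at `U₀ = 1` + the plain-currency bridge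
    refine hP5base_of_HFP hd2 hη L hone hmem hs84 hcs12 ha ha2 (cubeFam false L a M ρ k) (cubeLamS L a M ρ k) h66
      fun A hdat => ?_
    classical
    obtain ⟨S, hS⟩ : ∃ S : Finset (Site d), ∀ x, x ∈ S ↔ x ∈ cubeFam false L a M ρ k 0 :=
      ⟨(cubeFam_zero_finite L a M ρ k).toFinset, fun x => Set.Finite.mem_toFinset _⟩
    obtain ⟨B, hB'⟩ := exists_towerFinset 1 (cubeLamS L a M ρ k 1) (fun j _ => cubeLamS_finite L a M ρ k 1 j)
    obtain ⟨rG, rH, rR⟩ := REAL 1 le_rfl hk S hS B hB' _ (fun _ _ => rfl) _ rfl _ rfl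
    obtain ⟨g, Δ, q, qs, Aw, c, H', g_rightΩ, c_range, hΔ, hqs, hq, hH0, hH1, hH2, hHsupp, hHequiv, hQH, hG, hGsupp, hGreal, hRbd,
      hRreal⟩ := flatLettersRD_of_real (𝔸 := 𝔸) hd0 hη hL1 1 (cubeFam false L a M ρ k)
        (fun j _ => cubeFam_subset_zero hL1 a M hρL k j) (cubeLamS L a M ρ k 1) w hw S hS (tower_meets_cube hL1 a M hρL hk)
        (towers_disjoint_cube hL1 a M hρL hk) B hB' _ (fun _ _ => rfl) _ rfl _ rfl rG rH rR
    exact sockHFP₀_body_of_join_RD hd2 hL hη hk hΩc (htw 1 hk) hα₀' hα₁' hB₀ hB₀' rfl rfl hone h33 h34 hAx hdat g Δ q qs Aw c g_rightΩ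
      c_range hΔ hqs hq H' hB₀'H hB₂' hBG hBR hH0 hH1 hH2 hHsupp hHequiv hQH hG hGsupp hGreal hRbd hRreal le_rfl le_rfl le_rfl hα3'
      hα4' hsmallW hc₃ hsc hα₃' hs₁ hs₂ hs₃ hs₄ hs₅ hs₆ hs₇ hsm hprod8 rfl rfl rfl rfl hcA' ha₁' hb₁' hθ h103 h106
  · -- `P5step₁`: the step body at `U₀ = 1` with its (1.59) clause read off `H59₁` + the plain-currency bridge
    refine hP5_of_HFP hd2 hη L k hone hs84 hcs12 (cubeFam false L a M ρ k) (cubeLamS L a M ρ k)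
      fun m hm1 hmk u₁ U₁ A hu₁ hu₁S hW h129 hLan hdat => ?_
    classical
    obtain ⟨S, hS⟩ : ∃ S : Finset (Site d), ∀ x, x ∈ S ↔ x ∈ cubeFam false L a M ρ k 0 :=
      ⟨(cubeFam_zero_finite L a M ρ k).toFinset, fun x => Set.Finite.mem_toFinset _⟩
    obtain ⟨B, hB'⟩ := exists_towerFinset (m + 1) (cubeLamS L a M ρ k (m + 1)) (fun j _ => cubeLamS_finite L a M ρ k (m + 1) j)
    obtain ⟨rG, rH, rR⟩ := REAL (m + 1) (by omega) hmk S hS B hB' _ (fun _ _ => rfl) _ rfl _ rfl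
    obtain ⟨g, Δ, q, qs, Aw, c, H', g_rightΩ, c_range, hΔ, hqs, hq, hH0, hH1, hH2, hHsupp, hHequiv, hQH, hG, hGsupp, hGreal, hRbd,
      hRreal⟩ := flatLettersRD_of_real (𝔸 := 𝔸) hd0 hη hL1 (m + 1) (cubeFam false L a M ρ k)
        (fun j _ => cubeFam_subset_zero hL1 a M hρL k j) (cubeLamS L a M ρ k (m + 1)) w hw S hS (tower_meets_cube hL1 a M hρL hmk)
        (towers_disjoint_cube hL1 a M hρL hmk) B hB' _ (fun _ _ => rfl) _ rfl _ rfl rG rH rR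
    have hcDAlo : (d : ℝ) * (L : ℝ) ^ 2 * (5 * (d : ℝ) * L * B₀ * ((L : ℝ) ^ 3 * α₀ + 6 * d * (L : ℝ) ^ 2 * M * α₀)) ≤
        2 * (d : ℝ) * (L : ℝ) ^ 2 * (5 * (d : ℝ) * L * B₀ * ((L : ℝ) ^ 3 * α₀ + 6 * d * (L : ℝ) ^ 2 * M * α₀)) := by
      have h := mul_nonneg (by positivity : (0 : ℝ) ≤ (d : ℝ) * (L : ℝ) ^ 2) hcs0
      linarith only [h]
    -- Theorem 4's two-member (1.59) clause WITH THE EXTERIOR-COLLAR ALLOWANCE for this datum, from `H59D₁` (allowance `c⋆ ≤ 2Lc⋆ + 8α₄`)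
    have H59Dβm : ∀ A' : Site d → Fin d → 𝔸, (∀ y τ, IsSelfAdjoint (A' y τ)) →
        (∀ j, j ≤ m → ∀ (y : Site d) (τ : Fin d), SideTouches (cubeFam false L a M ρ k j) y τ →
          U₁ y τ = cfgExp η A' y τ ∧
            ‖A' y τ‖ ≤ (5 * (d : ℝ) * L * B₀ * ((L : ℝ) ^ 3 * α₀ + 6 * d * (L : ℝ) ^ 2 * M * α₀)) * ((L : ℝ) ^ j * η)⁻¹) →
        (∀ (y : Site d) (τ : Fin d), (∀ j, j ≤ m → ¬ SideTouches (cubeFam false L a M ρ k j) y τ) → A' y τ = 0) →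
        msup L m η (-(1 : ℝ)) (fun j (b : Site d × Fin d) => SideTouches (cubeFam false L a M ρ k j) b.1 b.2) (fun b => A' b.1 b.2)
            ≤ B₀ * (bondNorm L m η (-(3 : ℝ)) (cubeFam false L a M ρ k) (fun x μ => Jcur η (1 : Site d → Fin d → 𝔸ˣ) A' μ x)
              + wsup 1 (fun p : {p : ℕ × (Site d × Fin d) // p.1 ≤ m ∧ (p.2 ∈ cubeLamBP' L a M ρ k m p.1 ∨ (p.1 = 0 ∧ CrossB (cubeFam false L a M ρ k 0) p.2))} =>
                  linCovIter L (1 : Site d → Fin d → 𝔸ˣ) (iEta η A') p.1.1 p.1.2.1 p.1.2.2))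
              + Bbd * msup L m η (-(1 : ℝ)) (fun j (b : Site d × Fin d) => j = 0 ∧ SideTouches (cubeFam false L a M ρ k 0) b.1 b.2 ∧
                  ¬ BondTouches (cubeFam false L a M ρ k 0) b.1 b.2) (fun b => A' b.1 b.2) ∧
          msup L m η (-(2 : ℝ)) (fun j (t : Fin d × Fin d × Site d) => SideTouches (cubeFam false L a M ρ k j) t.2.2 t.2.1)
              (fun t => covDerivFwd η (1 : Site d → Fin d → 𝔸ˣ) t.1 (fun z => A' z t.2.1) t.2.2)
            ≤ B₀ * (bondNorm L m η (-(3 : ℝ)) (cubeFam false L a M ρ k) (fun x μ => Jcur η (1 : Site d → Fin d → 𝔸ˣ) A' μ x)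
              + wsup 1 (fun p : {p : ℕ × (Site d × Fin d) // p.1 ≤ m ∧ (p.2 ∈ cubeLamBP' L a M ρ k m p.1 ∨ (p.1 = 0 ∧ CrossB (cubeFam false L a M ρ k 0) p.2))} =>
                  linCovIter L (1 : Site d → Fin d → 𝔸ˣ) (iEta η A') p.1.1 p.1.2.1 p.1.2.2))
              + Bbd * msup L m η (-(1 : ℝ)) (fun j (b : Site d × Fin d) => j = 0 ∧ SideTouches (cubeFam false L a M ρ k 0) b.1 b.2 ∧
                  ¬ BondTouches (cubeFam false L a M ρ k 0) b.1 b.2) (fun b => A' b.1 b.2) := by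
      intro A' hsa hWA hA0
      refine H59 m hm1 hmk.le u₁ U₁ A' hu₁ hu₁S hW h129 hLan hsa (fun j hj y τ hs => ⟨(hWA j hj y τ hs).1, (hWA j hj y τ hs).2.trans ?_⟩)
        hA0
      have hw0 : 0 ≤ ((L : ℝ) ^ j * η)⁻¹ := by positivity
      refine mul_le_mul_of_nonneg_right ?_ hw0
      have h1 : 5 * (d : ℝ) * L * B₀ * ((L : ℝ) ^ 3 * α₀ + 6 * d * (L : ℝ) ^ 2 * M * α₀) ≤
          L * (5 * (d : ℝ) * L * B₀ * ((L : ℝ) ^ 3 * α₀ + 6 * d * (L : ℝ) ^ 2 * M * α₀)) := le_mul_of_one_le_left hcs0 hLr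
      linarith only [h1, hcs0, hα₄0]
    exact sockHFP_body_of_join_59_γ hd2 hL hη hΩc hboxc hclassc hm1 hmk (htw (m + 1) hmk) (h8lt m hmk) (h8top m hmk) hα₀' hα₁' hB₀
      hB₀' rfl rfl hone hmem h33 h34 hAx h135 h66 (bdryLayer_cubeMember hL a M ρ k hρL hk) hBbd hBd hu₁ hu₁S hW h129 hLan hdat H59Dβm hside g13 h61γ hsmall₁ g5 g6 h16γ hsmallγ hc₃γ
      g Δ q qs Aw c g_rightΩ c_range hΔ hqs hq
      H' hB₀'H hB₂' hBG hBR hH0 hH1 hH2 hHsupp hHequiv hQH hG hGsupp hGreal hRbd hRreal le_rfl le_rfl hcDAlo hα3' hα4' hsmallW hc₃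
      hsc hα₃' hs₁ hs₂ hs₃ hs₄ hs₅ hs₆ hs₇ hsm hprod8 rfl rfl rfl rfl hcA' ha₁' hb₁' hθ h103 h106

#print axioms prop6_cubeMember_flat_of_real_γ

open Classical in
/-- ★★ **PROPOSITION 6 (p. 99), EXISTENCE HALF, AT THE CONCRETE CUBE MEMBER FROM THREE REAL INEQUALITY FAMILIES AND THE SCALAR FLAT (1.59) γ
CLAUSE WITH EXTERIOR DATA.**  `prop6_cubeMember_flat_of_real_γ` with its gauge-field hypothesis `H59Dβ₁` replaced by the SCALAR flat two-line clause at every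
truncation over the split print class (`B8Ineq159FlatOfScalarBdryBeta.flat159_clause_of_scalar_bdryβ`, the class-parametric `⊗ id` transfer, at `Λb := cubeLamBP'
… m`): NO gauge-field hypothesis remains — three REAL families on the explicit flat Dirichlet matrices + the scalar γ clauses ([4] Thm 3.3 at `U = 1`, a-priori
form, abelian, print's class; per-cube inhabitant dag-n05-w3 p585691).
[cite: Balaban1985RegularSpaces, Prop. 6 p.99, Thm 4 p.88, Prop. 5 pp.93–94, (1.59) p.86, (1.31) p.82; Balaban1985BackgroundPropagators, Thms 3.1–3.3 pp.397–399, p.394 («⊗ identity»)] -/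
theorem prop6_cubeMember_flat_of_scalar_γ (hd2 : 2 ≤ d) {L : ℕ} (hL : 2 ≤ L) {B₀ B₀' B₀'H B₂' BG BR : ℝ} (hB₀ : 0 < B₀) (hB₀' : 0 < B₀')
    (hB : 2 ≤ 5 * (d : ℝ) * L * B₀) (hB₀'H : 0 < B₀'H) (hB₂' : 0 ≤ B₂') (hBG : 0 ≤ BG) (hBR : 0 ≤ BR)
    (hfree : 3 * (2 * (d : ℝ) * (L : ℝ) ^ 2) * BG * BR ≤ B₀') {Bbd : ℝ} (hBbd : 0 ≤ Bbd) (hBd : 4 * Bbd ≤ ((d : ℝ) * L - 1) * B₀) :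
    ∃ c₁ : ℝ, 0 < c₁ ∧ ∀ (η : ℝ), 0 < η → ∀ (k : ℕ), 1 ≤ k → ∀ (a : Site d) (M ρ : ℕ), L ≤ ρ → ρ ≤ M → 11 * (d : ℝ) < M →
      ∀ (U₀ : Site d → Fin d → 𝔸ˣ), (∀ x κ, U₀ x κ ∈ unitaryUnits 𝔸) → ∀ (α₀ : ℝ), 0 < α₀ →
      C0 d * (α₀ * (L : ℝ) ^ 2) ≤ 1 / 3 → 2 * (α₀ * (L : ℝ) ^ 2) ≤ c2' d L →
      ∀ (Ω : ℕ → Set (Site d)), InAk L k η α₀ Ω U₀ → tcube L a M ρ k ⊆ Ω (k - 1) →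
      11 * (d : ℝ) ^ 2 * (L : ℝ) ^ 2 * α₀ + ((M : ℝ) + 4 * ρ) * d * (L : ℝ) ^ 2 * α₀ ≤ 1 / 6 →
      (L : ℝ) ^ 3 * α₀ + 6 * d * (L : ℝ) ^ 2 * M * α₀ ≤ c₁ →
      -- the weights of `Q′ᵀaQ′` (free, nonnegative) and THE THREE REAL INEQUALITY FAMILIES at every truncation `n ≤ k` on the explicit matrices
      ∀ (w : ℕ → ℝ), (∀ j, 0 ≤ w j) →
      (∀ n, 1 ≤ n → n ≤ k → ∀ (S : Finset (Site d)), (∀ x, x ∈ S ↔ x ∈ cubeFam false L a M ρ k 0) →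
        ∀ (B : Finset (ℕ × Site d)), (∀ p, p ∈ B ↔ p.1 ≤ n ∧ p.2 ∈ cubeLamS L a M ρ k n p.1) →
        ∀ (K : Site d → Site d → ℝ), (∀ x z, K x z =
          ((η ^ 2)⁻¹ * ∑ μ : Fin d, ((2 : ℝ) * (if z = x then (1 : ℝ) else 0) - (if z = x + e μ then (1 : ℝ) else 0)
            - (if z = x - e μ then (1 : ℝ) else 0))) +
          (∑ j ∈ Finset.range (n + 1), (if blockMap (L ^ j) x ∈ cubeLamS L a M ρ k n j ∧ blockMap (L ^ j) z = blockMap (L ^ j) x then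
            w j * ((((L : ℝ) ^ d)⁻¹) ^ j) ^ 2 else 0))) →
        ∀ (T : Matrix ↥S ↥S ℝ), T = Matrix.of (fun x z : ↥S => K x.1 z.1) →
        ∀ (Q : Matrix ↥B ↥S ℝ), Q = Matrix.of (fun (p : ↥B) (z : ↥S) =>
          if blockMap (L ^ p.1.1) z.1 = p.1.2 then (((L : ℝ) ^ d)⁻¹) ^ p.1.1 else 0) →
        -- (1.101) for `T⁻¹`, real lattice functions
        (∀ (ρ' : ↥S → ℝ) (r : ℝ), 0 ≤ r →
          (∀ j, j ≤ n → ∀ z : ↥S, z.1 ∈ cubeFam false L a M ρ k j → wt L η j ^ 2 * |ρ' z| ≤ r) →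
          ∀ φ : Site d → ℝ, (∀ x, x ∉ cubeFam false L a M ρ k 0 → φ x = 0) → (∀ v : ↥S, φ v.1 = ∑ z : ↥S, T⁻¹ v z * ρ' z) →
          (∀ x, |φ x| ≤ BG * r) ∧
          ∀ j, j ≤ n → ∀ p ∈ {b : Site d × Fin d | SideTouches (cubeFam false L a M ρ k j) b.1 b.2},
            wt L η j * |η⁻¹ * (φ (p.1 + e p.2) - φ p.1)| ≤ BG * r) ∧
        -- (1.92) and the p. 93 `Δ`-entry for `T⁻¹(T⁻¹Qᵀ)(QT⁻¹T⁻¹Qᵀ)⁻¹`, real `X`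
        (∀ (X : ↥B → ℝ) (s : ℝ), 0 ≤ s → (∀ p', |X p'| ≤ s) →
          ∀ φ : Site d → ℝ, (∀ x, x ∉ cubeFam false L a M ρ k 0 → φ x = 0) →
          (∀ v : ↥S, φ v.1 = ∑ p' : ↥B, (T⁻¹ * (T⁻¹ * Qᵀ) * (Q * T⁻¹ * T⁻¹ * Qᵀ)⁻¹) v p' * X p') →
          (∀ x, |φ x| ≤ B₀'H * s) ∧
          (∀ j, j ≤ n → ∀ p ∈ {b : Site d × Fin d | SideTouches (cubeFam false L a M ρ k j) b.1 b.2},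
            wt L η j * |η⁻¹ * (φ (p.1 + e p.2) - φ p.1)| ≤ B₀'H * s) ∧
          (∀ j, j ≤ n → ∀ x ∈ cubeFam false L a M ρ k j,
            wt L η j ^ 2 * |∑ μ : Fin d, (η ^ 2)⁻¹ * (2 * φ x - φ (x + e μ) - φ (x - e μ))| ≤ B₂' * s)) ∧
        -- (1.98) for `1 − T⁻¹Qᵀ(QT⁻¹T⁻¹Qᵀ)⁻¹QT⁻¹`, real lattice functions
        (∀ (ρ' : ↥S → ℝ) (r : ℝ), 0 ≤ r →
          (∀ j, j ≤ n → ∀ z : ↥S, z.1 ∈ cubeFam false L a M ρ k j → wt L η j ^ 2 * |ρ' z| ≤ r) →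
          ∀ j, j ≤ n → ∀ v : ↥S, v.1 ∈ cubeFam false L a M ρ k j →
            wt L η j ^ 2 * |ρ' v - ∑ z : ↥S, (T⁻¹ * (Qᵀ * ((Q * T⁻¹ * T⁻¹ * Qᵀ)⁻¹ * (Q * T⁻¹)))) v z * ρ' z| ≤ BR * r)) →
      -- THE SCALAR FLAT (1.59) CLAUSE WITH THE EXTERIOR-COLLAR ALLOWANCE at every truncation `m ≤ k`: ℂ-valued bond functions in the flat
      -- Landau gauge on the collars of `{□_j}` ([4] Thm 3.3 at `U = 1` for `G(1)` on the finite cube WITH exterior data, a-priori form, abelian)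
      (∀ m, 1 ≤ m → m ≤ k → ∀ φ : Site d → Fin d → ℂ,
        IsLandau138 L m η ((cubeFam false L a M ρ k) 0) ((cubeLamS L a M ρ k) m) (1 : Site d → Fin d → ℂˣ) φ →
        (∀ (y : Site d) (τ : Fin d), (∀ j, j ≤ m → ¬ SideTouches ((cubeFam false L a M ρ k) j) y τ) → φ y τ = 0) →
        msup L m η (-(1 : ℝ)) (fun j (b : Site d × Fin d) => SideTouches ((cubeFam false L a M ρ k) j) b.1 b.2) (fun b => φ b.1 b.2)
          ≤ B₀ * (bondNorm L m η (-(3 : ℝ)) (cubeFam false L a M ρ k) (fun x μ => Jcur η (1 : Site d → Fin d → ℂˣ) φ μ x)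
            + wsup 1 (fun p : {p : ℕ × (Site d × Fin d) // p.1 ≤ m ∧ (p.2 ∈ (cubeLamBP' L a M ρ k) m p.1 ∨ (p.1 = 0 ∧ CrossB ((cubeFam false L a M ρ k) 0) p.2))} =>
                linCovIter L (1 : Site d → Fin d → ℂˣ) (iEta η φ) p.1.1 p.1.2.1 p.1.2.2))
            + Bbd * msup L m η (-(1 : ℝ)) (fun j (b : Site d × Fin d) => j = 0 ∧ SideTouches ((cubeFam false L a M ρ k) 0) b.1 b.2 ∧
                ¬ BondTouches ((cubeFam false L a M ρ k) 0) b.1 b.2) (fun b => φ b.1 b.2) ∧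
        msup L m η (-(2 : ℝ)) (fun j (t : Fin d × Fin d × Site d) => SideTouches ((cubeFam false L a M ρ k) j) t.2.2 t.2.1)
            (fun t => covDerivFwd η (1 : Site d → Fin d → ℂˣ) t.1 (fun z => φ z t.2.1) t.2.2)
          ≤ B₀ * (bondNorm L m η (-(3 : ℝ)) (cubeFam false L a M ρ k) (fun x μ => Jcur η (1 : Site d → Fin d → ℂˣ) φ μ x)
            + wsup 1 (fun p : {p : ℕ × (Site d × Fin d) // p.1 ≤ m ∧ (p.2 ∈ (cubeLamBP' L a M ρ k) m p.1 ∨ (p.1 = 0 ∧ CrossB ((cubeFam false L a M ρ k) 0) p.2))} =>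
                linCovIter L (1 : Site d → Fin d → ℂˣ) (iEta η φ) p.1.1 p.1.2.1 p.1.2.2))
            + Bbd * msup L m η (-(1 : ℝ)) (fun j (b : Site d × Fin d) => j = 0 ∧ SideTouches ((cubeFam false L a M ρ k) 0) b.1 b.2 ∧
                ¬ BondTouches ((cubeFam false L a M ρ k) 0) b.1 b.2) (fun b => φ b.1 b.2)) →
      ∃ u : Site d → 𝔸ˣ, (∀ x, u x ∈ unitaryUnits 𝔸) ∧ (∀ x, x ∉ cubeFam false L a M ρ k 0 → u x = 1) ∧
        Restr129 L k (cubeLamS L a M ρ k k) (1 : Site d → Fin d → 𝔸ˣ) u ∧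
        IsLandau138W L k η (cubeFam false L a M ρ k 0) (cubeLamS L a M ρ k k) (1 : Site d → Fin d → 𝔸ˣ)
          (gaugeAct u⁻¹ (cutFixed L (tLo a ρ) (tHi a M ρ) U₀ k (ctr a M))) ∧
        (∀ j, j ≤ k → ∀ b ∈ {b : Site d × Fin d | SideTouches (cubeFam false L a M ρ k j) b.1 b.2},
          gaugeAct u⁻¹ (cutFixed L (tLo a ρ) (tHi a M ρ) U₀ k (ctr a M)) b.1 b.2 =
              cfgExp η (logCfg η (gaugeAct u⁻¹ (cutFixed L (tLo a ρ) (tHi a M ρ) U₀ k (ctr a M)))) b.1 b.2 ∧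
            IsSelfAdjoint (logCfg η (gaugeAct u⁻¹ (cutFixed L (tLo a ρ) (tHi a M ρ) U₀ k (ctr a M))) b.1 b.2) ∧
            ‖logCfg η (gaugeAct u⁻¹ (cutFixed L (tLo a ρ) (tHi a M ρ) U₀ k (ctr a M))) b.1 b.2‖ ≤
              (5 * (d : ℝ) * L * B₀ * ((L : ℝ) ^ 3 * α₀ + 6 * d * (L : ℝ) ^ 2 * M * α₀)) * ((L : ℝ) ^ j * η)⁻¹) ∧
        (∀ x, ((localGauge L (tLo a ρ) (tHi a M ρ) U₀ k (ctr a M))⁻¹ * u) x ∈ unitaryUnits 𝔸) ∧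
        AgreeOn (tlo L (tLo a ρ) k) (thi L (tHi a M ρ) k)
          (gaugeAct ((localGauge L (tLo a ρ) (tHi a M ρ) U₀ k (ctr a M))⁻¹ * u)⁻¹ U₀)
          (gaugeAct u⁻¹ (cutFixed L (tLo a ρ) (tHi a M ρ) U₀ k (ctr a M))) := by
  have hL1 : 1 ≤ L := le_trans (by norm_num) hL
  have hLpos : (0 : ℝ) < L := by exact_mod_cast (lt_of_lt_of_le (by norm_num) hL1)
  have hdpos : (0 : ℝ) < d := by exact_mod_cast (lt_of_lt_of_le (by norm_num) hd2 : 0 < d)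
  obtain ⟨c₁, hc₁, H⟩ := prop6_cubeMember_flat_of_real_γ (𝔸 := 𝔸) hd2 hL hB₀ hB₀' hB hB₀'H hB₂' hBG hBR hfree hBbd hBd
  -- the allowance of the step datum's exponents is `Kc·(L³α₀ + 6dL²Mα₀)`; below `1/(2Kc)` it is `≤ 1/2`, as the `⊗ id` transfer wants
  set Kc : ℝ := 2 * (L * (5 * (d : ℝ) * L * B₀)) + 8 * (8 * B₀' * (5 * (d : ℝ) * L * B₀)) with hKc_def
  have hKc : 0 < Kc := by positivity
  refine ⟨min c₁ (1 / (2 * Kc)), lt_min hc₁ (by positivity), ?_⟩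
  intro η hη k hk a M ρ hρL hρM hM U₀ hU₀ α₀ hα hα3 hα2 Ω hA hT hsmall hc w hw REAL SCALAR
  have hc1 : (L : ℝ) ^ 3 * α₀ + 6 * d * (L : ℝ) ^ 2 * M * α₀ ≤ c₁ := hc.trans (min_le_left _ _)
  have hcK : (L : ℝ) ^ 3 * α₀ + 6 * d * (L : ℝ) ^ 2 * M * α₀ ≤ 1 / (2 * Kc) := hc.trans (min_le_right _ _)
  have hs0 : 0 ≤ (L : ℝ) ^ 3 * α₀ + 6 * d * (L : ℝ) ^ 2 * M * α₀ := by positivity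
  -- the allowance `c` of `H59D₁` and its window `0 ≤ c ≤ 1/2`
  have hcoef : 2 * (L * (5 * (d : ℝ) * L * B₀ * (((L : ℝ) ^ 3 * α₀) + (6 * d * (L : ℝ) ^ 2 * M * α₀)))) +
      8 * (8 * B₀' * (5 * (d : ℝ) * L * B₀) * (((L : ℝ) ^ 3 * α₀) + (6 * d * (L : ℝ) ^ 2 * M * α₀))) =
      Kc * ((L : ℝ) ^ 3 * α₀ + 6 * d * (L : ℝ) ^ 2 * M * α₀) := by rw [hKc_def]; ring
  have hc0 : 0 ≤ 2 * (L * (5 * (d : ℝ) * L * B₀ * (((L : ℝ) ^ 3 * α₀) + (6 * d * (L : ℝ) ^ 2 * M * α₀)))) +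
      8 * (8 * B₀' * (5 * (d : ℝ) * L * B₀) * (((L : ℝ) ^ 3 * α₀) + (6 * d * (L : ℝ) ^ 2 * M * α₀))) := by
    rw [hcoef]; positivity
  have hchalf : 2 * (L * (5 * (d : ℝ) * L * B₀ * (((L : ℝ) ^ 3 * α₀) + (6 * d * (L : ℝ) ^ 2 * M * α₀)))) +
      8 * (8 * B₀' * (5 * (d : ℝ) * L * B₀) * (((L : ℝ) ^ 3 * α₀) + (6 * d * (L : ℝ) ^ 2 * M * α₀))) ≤ 1 / 2 := by
    rw [hcoef]
    calc Kc * ((L : ℝ) ^ 3 * α₀ + 6 * d * (L : ℝ) ^ 2 * M * α₀) ≤ Kc * (1 / (2 * Kc)) := mul_le_mul_of_nonneg_left hcK hKc.le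
      _ = 1 / 2 := by field_simp
  -- `H59D₁` from the scalar clause by the `⊗ id` transfer in the repaired currency, at every truncation
  refine H η hη k hk a M ρ hρL hρM hM U₀ hU₀ α₀ hα hα3 hα2 Ω hA hT hsmall hc1 w hw REAL ?_
  intro m hm1 hmk u W A' hu huS hW h129 hLan hsa hWA hA0
  exact flat159_clause_of_scalar_bdryβ hd2 hL1 hη m (cubeFam false L a M ρ k) (cubeLamS L a M ρ k m) (cubeLamBP' L a M ρ k m) hB₀.le
    hBbd hc0 hchalf (SCALAR m hm1 hmk) W A' hLan hWA hA0

#print axioms prop6_cubeMember_flat_of_scalar_γ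


end Literature.MathematicalPhysics.QuantumFieldTheory.Balaban1983to89.B8Prop6CubeMemberFlatScalarGamma

end
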